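import Mathlib
import Summits.FinalStateConjecture.FinalStateConjecture.Theorems.SoloInformedCombGenericity

/-!
# SoloInformed — Christodoulou's LINEAR positive codimension is category-blind already in the plane

Soloist `solo-FinalStateConjecture-informed`, session 20 (2026-08-19). Companion of `SoloInformedFinSupp` /
`SoloInformedCategoryBlind` on the GENERICITY QUANTIFIER of the summit `FinalStateConjecture`. Those files
show that the `C^∞`-curve notion (`IsTameChristodoulouGeneric … 1`, modelled by `escapable`) accepts a
comeagre exceptional set (`ℓ¹ ∖ c₀₀`) which the affine and the analytic notions reject. This file shows
that the AFFINE notion itself — Christodoulou's printed "positive codimension" (CQG 16 (1999) A23,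
p. A24; Ann. Math. 149 (1999) 183, Thm. 4.1), the Literature's `HasLinearCodimAtLeast` — is ALREADY
category-blind, in `ℝ²` with `m = 1`:

* `thinGδ`: a dense `G_δ` (hence comeagre, `thinGδ_mem_residual`) of the plane contained, for every `n`,
  in a union of balls `⋃ₖ B(qₖ, 2^{-(n+k+1)})` around a dense sequence — a "thin" comeagre set (of
  one-dimensional Hausdorff measure zero).
* `exists_good_slope`: through EVERY point `x` of the plane there is a line `x + t (1, σ)` meeting `thinGδ`
  at most in `x`: the set of bad slopes `σ` (with `|σ|, |t|, 1/|t| ≤ m + 1`) is covered, for each `n`, by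
  intervals of total length `≤ 4 (m+1)(m+2) 2^{-n}`, so it is Lebesgue-null, and a null set is not all of
  `ℝ`.
* `hasLinearCodimAtLeast_thinGδ : HasLinearCodimAtLeast univ thinGδ 1` and `thinGδ_subset_escapable`;
  `linearBlind`: a COMEAGRE set of LINEAR codimension one — the property `(· ∉ thinGδ)`, which FAILS on a
  comeagre set, is generic in Christodoulou's linear sense (and a fortiori in the `C^∞`-curve sense).

So no regularity requirement on the witness families (affine, analytic, `C^∞`) gives the codimension
notion any Baire-category content; only an explicit category (or prevalence) clause would. (For Lebesgue
MEASURE in the plane the affine notion is blind as well: Nikodym's set — a full-measure subset of the unit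
square each point of which is "linearly accessible", Nikodym 1927, Davies 1952; Falconer, *The Geometry of
Fractal Sets*, §7.1. The present comeagre example is Lebesgue-null; the construction is elementary and
we have not found it recorded.) References: Christodoulou [Christodoulou1999, p. A24]; Oxtoby, *Measure
and Category*, Ch. 1; Falconer, op. cit.
-/

noncomputable section

set_option linter.dupNamespace false

open Set Filter Topology Metric MeasureTheory Literature.Geometry.Lorentzian
open scoped ENNReal ContDiff

namespace Summit.FinalStateConjecture.FinalStateConjecture.Theorems

/-! ### A thin dense `G_δ` in the plane -/

/-- A dense sequence in the plane. [folklore] -/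
def denseSeq : ℕ → ℝ × ℝ := (TopologicalSpace.exists_dense_seq (ℝ × ℝ)).choose

/-- The chosen sequence is dense. [folklore] -/
theorem denseRange_denseSeq : DenseRange denseSeq :=
  (TopologicalSpace.exists_dense_seq (ℝ × ℝ)).choose_spec

/-- The radii `2^{-(n+k+1)}`. [folklore] -/
def rad (n k : ℕ) : ℝ := (1 / 2 : ℝ) ^ (n + k + 1)

/-- The radii are positive. [folklore] -/
theorem rad_pos (n k : ℕ) : 0 < rad n k := pow_pos (by norm_num) _

/-- `∑ₖ 2^{-(n+k+1)} = 2^{-n}`. [folklore] -/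
theorem hasSum_rad (n : ℕ) : HasSum (rad n) ((1 / 2 : ℝ) ^ n) := by
  have h := (hasSum_geometric_of_lt_one (by norm_num : (0 : ℝ) ≤ 1 / 2) (by norm_num)).mul_left
    ((1 / 2 : ℝ) ^ (n + 1))
  have h1 : (1 - 1 / 2 : ℝ)⁻¹ = 2 := by norm_num
  have h2 : (1 / 2 : ℝ) ^ (n + 1) * (1 - 1 / 2)⁻¹ = (1 / 2 : ℝ) ^ n := by
    rw [h1, pow_succ]; ring
  rw [h2] at h
  have hf : rad n = fun k ↦ (1 / 2 : ℝ) ^ (n + 1) * (1 / 2 : ℝ) ^ k := by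
    funext k
    rw [rad]; ring
  rw [hf]
  exact h

/-- The radii are summable in `k`. [folklore] -/
theorem summable_rad (n : ℕ) : Summable (rad n) := (hasSum_rad n).summable

/-- `∑ₖ rad n k = 2^{-n}`. [folklore] -/
theorem tsum_rad (n : ℕ) : ∑' k, rad n k = (1 / 2 : ℝ) ^ n := (hasSum_rad n).tsum_eq

/-- The `n`-th open cover of the dense sequence: `⋃ₖ B(qₖ, 2^{-(n+k+1)})`. [folklore] -/
def cover (n : ℕ) : Set (ℝ × ℝ) := ⋃ k, ball (denseSeq k) (rad n k)

/-- Each cover is open. [folklore] -/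
theorem isOpen_cover (n : ℕ) : IsOpen (cover n) := isOpen_iUnion fun _ ↦ isOpen_ball

/-- Each cover is dense (it contains the dense sequence). [folklore] -/
theorem dense_cover (n : ℕ) : Dense (cover n) := by
  refine Dense.mono ?_ denseRange_denseSeq
  rintro _ ⟨k, rfl⟩
  exact mem_iUnion.mpr ⟨k, mem_ball_self (rad_pos n k)⟩

/-- The thin dense `G_δ`: `⋂ₙ ⋃ₖ B(qₖ, 2^{-(n+k+1)})`. [folklore] -/
def thinGδ : Set (ℝ × ℝ) := ⋂ n, cover n

/-- `thinGδ ⊆ cover n`. [folklore] -/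
theorem thinGδ_subset_cover (n : ℕ) : thinGδ ⊆ cover n := iInter_subset _ n

/-- The thin set is dense (Baire). [folklore] -/
theorem dense_thinGδ : Dense thinGδ := dense_iInter_of_isOpen isOpen_cover dense_cover

/-- The thin set is a `G_δ`. [folklore] -/
theorem isGδ_thinGδ : IsGδ thinGδ := .iInter_of_isOpen isOpen_cover

/-- The thin set is comeagre. [folklore] -/
theorem thinGδ_mem_residual : thinGδ ∈ residual (ℝ × ℝ) :=
  residual_of_dense_Gδ isGδ_thinGδ dense_thinGδ

/-! ### Through every point passes a line missing the thin set elsewhere -/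

/-- The point of parameter `t` on the line of slope `σ` through `x`. [folklore] -/
theorem line_fst (x : ℝ × ℝ) (t σ : ℝ) : (x + t • ((1 : ℝ), σ)).1 = x.1 + t := by
  simp

/-- Second coordinate of the same point. [folklore] -/
theorem line_snd (x : ℝ × ℝ) (t σ : ℝ) : (x + t • ((1 : ℝ), σ)).2 = x.2 + t * σ := by
  simp

/-- The slopes `σ`, `|σ| ≤ m+1`, for which the line through `x` meets the `k`-th ball of the `n`-th cover at
a parameter `t` with `1/(m+1) ≤ |t| ≤ m+1`. [folklore] -/
def slab (x : ℝ × ℝ) (m n k : ℕ) : Set ℝ :=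
  {σ | |σ| ≤ m + 1 ∧ ∃ t : ℝ, 1 / (m + 1 : ℝ) ≤ |t| ∧ |t| ≤ m + 1 ∧
    x + t • ((1 : ℝ), σ) ∈ ball (denseSeq k) (rad n k)}

/-- Two slopes in the same slab differ by at most `2 r (m+1)(m+2)`. [folklore] -/
theorem dist_le_of_mem_slab {x : ℝ × ℝ} {m n k : ℕ} {σ σ₀ : ℝ} (hσ : σ ∈ slab x m n k)
    (hσ₀ : σ₀ ∈ slab x m n k) : dist σ σ₀ ≤ 2 * rad n k * (m + 1) * (m + 2) := by
  obtain ⟨-, t, ht1, ht2, hp⟩ := hσ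
  obtain ⟨hσ₀b, t₀, -, -, hp₀⟩ := hσ₀
  set r := rad n k with hr
  have hm : (0 : ℝ) < m + 1 := by positivity
  have hd : dist (x + t • ((1 : ℝ), σ)) (x + t₀ • ((1 : ℝ), σ₀)) < 2 * r := by
    calc dist (x + t • ((1 : ℝ), σ)) (x + t₀ • ((1 : ℝ), σ₀))
        ≤ dist (x + t • ((1 : ℝ), σ)) (denseSeq k) + dist (denseSeq k) (x + t₀ • ((1 : ℝ), σ₀)) :=
          dist_triangle _ _ _
      _ < r + r := add_lt_add (mem_ball.mp hp) (by rw [dist_comm]; exact mem_ball.mp hp₀)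
      _ = 2 * r := by ring
  rw [Prod.dist_eq, max_lt_iff, Real.dist_eq, Real.dist_eq, line_fst, line_fst, line_snd, line_snd] at hd
  obtain ⟨h1, h2⟩ := hd
  rw [add_sub_add_left_eq_sub] at h1 h2
  -- `|t| |σ - σ₀| ≤ |tσ - t₀σ₀| + |t - t₀| |σ₀| < 2r + 2r (m+1)`
  have h3 : |t| * |σ - σ₀| ≤ 2 * r + 2 * r * (m + 1) := by
    have : t * (σ - σ₀) = (t * σ - t₀ * σ₀) - (t - t₀) * σ₀ := by ring
    rw [← abs_mul, this]
    refine (abs_sub _ _).trans ?_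
    rw [abs_mul]
    nlinarith [abs_nonneg (t - t₀), abs_nonneg σ₀]
  have ht0 : 0 < |t| := lt_of_lt_of_le (by positivity) ht1
  rw [Real.dist_eq]
  calc |σ - σ₀| = (|t| * |σ - σ₀|) / |t| := by field_simp
    _ ≤ (2 * r + 2 * r * (m + 1)) / |t| := div_le_div_of_nonneg_right h3 ht0.le
    _ ≤ (2 * r + 2 * r * (m + 1)) / (1 / (m + 1)) :=
        div_le_div_of_nonneg_left (by nlinarith [rad_pos n k]) (by positivity) ht1
    _ = 2 * r * (m + 1) * (m + 2) := by field_simp; ring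

/-- Each slab has Lebesgue (outer) measure `≤ 4 r (m+1)(m+2)`. [folklore] -/
theorem volume_slab_le (x : ℝ × ℝ) (m n k : ℕ) :
    volume (slab x m n k) ≤ ENNReal.ofReal (4 * rad n k * (m + 1) * (m + 2)) := by
  rcases (slab x m n k).eq_empty_or_nonempty with h | ⟨σ₀, hσ₀⟩
  · rw [h, measure_empty]; exact bot_le
  · have hsub : slab x m n k ⊆ closedBall σ₀ (2 * rad n k * (m + 1) * (m + 2)) :=
      fun σ hσ ↦ mem_closedBall.mpr (dist_le_of_mem_slab hσ hσ₀)
    refine (measure_mono hsub).trans ?_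
    rw [Real.volume_closedBall]
    exact ENNReal.ofReal_le_ofReal (by ring_nf; exact le_rfl)

/-- The bad slopes at scale `m`: `|σ| ≤ m+1` and the line meets `thinGδ` at a parameter `t` with
`1/(m+1) ≤ |t| ≤ m+1`. [folklore] -/
def badSlopes (x : ℝ × ℝ) (m : ℕ) : Set ℝ :=
  {σ | |σ| ≤ m + 1 ∧ ∃ t : ℝ, 1 / (m + 1 : ℝ) ≤ |t| ∧ |t| ≤ m + 1 ∧ x + t • ((1 : ℝ), σ) ∈ thinGδ}

/-- The bad slopes at scale `m` lie in the slabs of every cover. [folklore] -/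
theorem badSlopes_subset (x : ℝ × ℝ) (m n : ℕ) : badSlopes x m ⊆ ⋃ k, slab x m n k := by
  rintro σ ⟨hσ, t, ht1, ht2, hmem⟩
  obtain ⟨k, hk⟩ := mem_iUnion.mp (thinGδ_subset_cover n hmem)
  exact mem_iUnion.mpr ⟨k, hσ, t, ht1, ht2, hk⟩

/-- The bad slopes at scale `m` have measure `≤ 4 (m+1)(m+2) 2^{-n}` for every `n` … [folklore] -/
theorem volume_badSlopes_le (x : ℝ × ℝ) (m n : ℕ) :
    volume (badSlopes x m) ≤ ENNReal.ofReal (4 * (1 / 2 : ℝ) ^ n * (m + 1) * (m + 2)) := by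
  have hC : (0 : ℝ) ≤ 4 * (m + 1) * (m + 2) := by positivity
  calc volume (badSlopes x m) ≤ volume (⋃ k, slab x m n k) := measure_mono (badSlopes_subset x m n)
    _ ≤ ∑' k, volume (slab x m n k) := measure_iUnion_le _
    _ ≤ ∑' k, ENNReal.ofReal (4 * rad n k * (m + 1) * (m + 2)) :=
        ENNReal.tsum_le_tsum fun k ↦ volume_slab_le x m n k
    _ = ENNReal.ofReal (∑' k, 4 * rad n k * (m + 1) * (m + 2)) := by
        rw [ENNReal.ofReal_tsum_of_nonneg]
        · intro k
          have := rad_pos n k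
          positivity
        · have : (fun k ↦ 4 * rad n k * (m + 1) * (m + 2)) = fun k ↦ (4 * (m + 1) * (m + 2)) * rad n k := by
            funext k; ring
          rw [this]
          exact (summable_rad n).mul_left _
    _ = ENNReal.ofReal (4 * (1 / 2 : ℝ) ^ n * (m + 1) * (m + 2)) := by
        have : (fun k ↦ 4 * rad n k * (m + 1) * (m + 2)) = fun k ↦ (4 * (m + 1) * (m + 2)) * rad n k := by
          funext k; ring
        rw [this, tsum_mul_left, tsum_rad]
        ring_nf

/-- … hence measure zero. [folklore] -/
theorem volume_badSlopes (x : ℝ × ℝ) (m : ℕ) : volume (badSlopes x m) = 0 := by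
  have hlim : Tendsto (fun n : ℕ ↦ ENNReal.ofReal (4 * (1 / 2 : ℝ) ^ n * (m + 1) * (m + 2))) atTop (𝓝 0) := by
    rw [← ENNReal.ofReal_zero]
    refine ENNReal.tendsto_ofReal ?_
    have h := (tendsto_pow_atTop_nhds_zero_of_lt_one (by norm_num : (0 : ℝ) ≤ 1 / 2) (by norm_num))
    have h2 : Tendsto (fun n : ℕ ↦ 4 * (1 / 2 : ℝ) ^ n * (m + 1) * (m + 2)) atTop
        (𝓝 (4 * 0 * (m + 1) * (m + 2))) :=
      ((h.const_mul 4).mul_const _).mul_const _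
    simpa using h2
  exact le_antisymm (ge_of_tendsto' hlim fun n ↦ volume_badSlopes_le x m n) bot_le

/-- **Through every point of the plane there is a line meeting `thinGδ` at most in that point.**
(The union over `m` of the bad slope sets is Lebesgue-null, and `[-1, 1]` is not.) [folklore] -/
theorem exists_good_slope (x : ℝ × ℝ) : ∃ σ : ℝ, ∀ t : ℝ, t ≠ 0 → x + t • ((1 : ℝ), σ) ∉ thinGδ := by
  have hnull : volume (⋃ m, badSlopes x m) = 0 := measure_iUnion_null fun m ↦ volume_badSlopes x m
  have hnot : ¬ closedBall (0 : ℝ) 1 ⊆ ⋃ m, badSlopes x m := by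
    intro hsub
    have h1 := measure_mono (μ := volume) hsub
    rw [hnull, Real.volume_closedBall] at h1
    have : ENNReal.ofReal (2 * 1) = 0 := le_antisymm h1 bot_le
    rw [ENNReal.ofReal_eq_zero] at this
    linarith
  obtain ⟨σ, -, hσ⟩ := not_subset.mp hnot
  refine ⟨σ, fun t ht hmem ↦ hσ ?_⟩
  -- choose the scale `m`
  obtain ⟨m, hm⟩ := exists_nat_ge (max |σ| (max |t| |t|⁻¹))
  have hσm : |σ| ≤ m + 1 := by
    linarith [(le_max_left _ _).trans hm]
  have htm : |t| ≤ m + 1 := by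
    linarith [((le_max_left _ _).trans (le_max_right _ _)).trans hm]
  have htinv : |t|⁻¹ ≤ (m : ℝ) + 1 := by
    linarith [((le_max_right _ _).trans (le_max_right _ _)).trans hm]
  have htpos : 0 < |t| := abs_pos.mpr ht
  have htm' : 1 / ((m : ℝ) + 1) ≤ |t| := by
    rw [one_div_le (by positivity) htpos, one_div]
    exact htinv
  exact mem_iUnion.mpr ⟨m, hσm, t, htm', htm, hmem⟩

/-! ### Linear codimension one of a comeagre set -/

/-- The direction `(1, σ)` is non-zero. [folklore] -/
theorem dir_ne_zero (σ : ℝ) : ((1 : ℝ), σ) ≠ 0 := by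
  intro h
  have := congrArg Prod.fst h
  simp at this

/-- **The comeagre set `thinGδ` has Christodoulou's LINEAR codimension one** (`Genericity.lean`).
[cite: Christodoulou1999, p. A24] -/
theorem hasLinearCodimAtLeast_thinGδ : HasLinearCodimAtLeast (univ : Set (ℝ × ℝ)) thinGδ 1 := by
  intro d _
  obtain ⟨σ, hσ⟩ := exists_good_slope d
  refine ⟨fun _ ↦ ((1 : ℝ), σ), linearIndependent_unique_iff.mpr (dir_ne_zero σ), fun _ ↦ mem_univ _, ?_⟩
  intro c hc
  rw [Fin.sum_univ_one]
  have hc0 : c 0 ≠ 0 := by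
    intro h
    apply hc
    funext i
    rw [Subsingleton.elim i 0, h]
    rfl
  exact hσ (c 0) hc0

/-- The same lines are `C^∞` escaping curves: `thinGδ` has comb codimension one in the model of
`SoloInformedCombGenericity` as well. [folklore] -/
theorem thinGδ_subset_escapable : thinGδ ⊆ escapable univ thinGδ := by
  intro d _
  obtain ⟨σ, hσ⟩ := exists_good_slope d
  have hd : HasDerivAt (fun c : ℝ ↦ d + c • ((1 : ℝ), σ)) ((1 : ℝ) • ((1 : ℝ), σ)) 0 :=
    ((hasDerivAt_id (0 : ℝ)).smul_const _).const_add d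
  refine ⟨fun c ↦ d + c • ((1 : ℝ), σ), ?_, ?_, ?_, ?_, fun _ ↦ mem_univ _, fun c hc ↦ hσ c hc⟩
  · exact contDiff_const.add (contDiff_id.smul contDiff_const)
  · rw [hd.deriv, one_smul]
    exact dir_ne_zero σ
  · simp
  · intro a b h
    exact smul_left_injective ℝ (dir_ne_zero σ) (add_left_cancel h)

/-- A comeagre set and its complement are not both residual (the plane is a nonempty Baire space).
[folklore] -/
theorem not_isTopologicallyGeneric_notMem_thinGδ :
    ¬ IsTopologicallyGeneric (fun d : ℝ × ℝ ↦ d ∉ thinGδ) := by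
  intro h
  have h2 : (∅ : Set (ℝ × ℝ)) ∈ residual (ℝ × ℝ) := by
    have h3 := inter_mem thinGδ_mem_residual h
    rwa [show {d : ℝ × ℝ | d ∉ thinGδ} = thinGδᶜ from rfl, inter_compl_self] at h3
  exact Set.not_nonempty_empty (dense_of_mem_residual h2).nonempty

/-- **Linear positive codimension is category-blind.** There is a dense comeagre subset `G` of the
plane of LINEAR codimension one (Christodoulou's printed notion, `m = 1`), a fortiori of comb
codimension one: the property `(· ∉ G)` is generic in the codimension sense although it FAILS on a
comeagre set (it is not topologically generic; its negation is). [folklore] -/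
theorem linearBlind :
    ∃ G : Set (ℝ × ℝ), Dense G ∧ G ∈ residual (ℝ × ℝ) ∧ HasLinearCodimAtLeast univ G 1 ∧
      G ⊆ escapable univ G ∧ IsTopologicallyGeneric (fun d ↦ d ∈ G) ∧
      ¬ IsTopologicallyGeneric (fun d ↦ d ∉ G) :=
  ⟨thinGδ, dense_thinGδ, thinGδ_mem_residual, hasLinearCodimAtLeast_thinGδ, thinGδ_subset_escapable,
    thinGδ_mem_residual, not_isTopologicallyGeneric_notMem_thinGδ⟩

end Summit.FinalStateConjecture.FinalStateConjecture.Theorems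

end
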